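import Summits.Ventures.HSemireg.WedgeModelCoord
import Literature.LinearAlgebra.Alternating.GradedForms

/-!
# Venture HSemireg — (S3)'s positivity input (H1) «∫_X bⁿ > 0»: the SIGN LAW `bⁿ = n!·(∏_a λ_a)·vol` (second proof route, part 1)

HONEST FRAMING. Part of the Lean index of the computation cell `pub-hsemireg` (TRACK «S4-PUSH» (ii), seat s4-prove-3,
SECOND proof route; work log `s4push/prove-3/ATTEMPT-1.md`).  FINITE-DIMENSIONAL EXTERIOR ALGEBRA OVER A COMMUTATIVE RING /
FIELD ONLY: no abelian variety, no Hodge structure, no sheaf, no Ext group, no semiregularity map and no integral is constructed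
here; nothing here says that HC, HC_CM or HC_AV holds, and nothing here is a new case of anything; no Literature fact is declared
or used.  The companion file `Mod4SignLawParity.lean` (part 2) carries the ordered-field sign bookkeeping and the SIGNED form of
the MOD-4 parity law.

WHAT (H1) IS (cell record).  STRUCTURE.md v1.0-SIGNED §2 (S3) «MOD-4 PARITY LAW» is PROVED (th-7, theory/FORMULA-N-th7.md §D;
referee read ref-4 2026-08-22T13:46:16Z) under three NAMED hypotheses, the first of which is (H1) «∫_X bⁿ > 0», where the secant
plane is `P ⊗ ℂ = ⟨c·e^B, c̄·e^{B̄}⟩`, `B = a + √-d·b`, `a, b ∈ NS(X)_ℚ`, `b` non-degenerate, on an abelian `n`-fold `X`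
(th-7 Def. A.2 / §D); §D computes `(v,v)_χ = 2|x|²|c|²(-4d)^{n/2}·∫_X bⁿ/n!` for even `n` and flags (H1) as «ARGUED in general from
positivity of the invariant polarisation h_P — not load-bearing for the rows of record (b ∝ Θ principal, ∫Θⁿ/n! = 1)».

WHAT THIS FILE PROVES (kernel, 0 sorry).  The exterior-algebra identity behind the sign of `∫_X bⁿ`:
* §1 `sum_smul_pow_eq` — for `n` pairwise commuting square-zero elements `z_a` of any `K`-algebra and scalars `c_a`,
  `(∑_a c_a z_a)^n = (n! · ∏_a c_a) · z_0 z_1 ⋯ z_{n-1}` (induction on `n`: the tree's nilpotent binomial formula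
  `Commute.add_pow_succ_of_sq_eq_zero` (Literature/LinearAlgebra/Alternating/GradedForms.lean) + absorption);
* §2 `diagForm_pow` — in the exterior algebra `Λ M` of ANY module `M` over any commutative ring, for any frame
  `(dx_a, dy_a)_{a<n}` and coefficients `λ_a`, with `ω_a := dx_a ∧ dy_a`, `b(λ) := ∑ λ_a ω_a`, `vol := ω_0 ∧ ⋯ ∧ ω_{n-1}`:
  **`b(λ)^n = (n! · ∏_a λ_a) · vol`**, hence `deg(b(λ)ⁿ) = n!·(∏λ_a)·deg(vol)` for every linear functional `deg`
  (`linearForm_diagForm_pow`; on paper `deg = ∫_X`);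
* §3 `vol_ne_zero` — in the cell's sign-free WEDGE MODEL (`Summit.Ventures.HSemireg.Wedge`: generators a finite linear order `I`,
  monomial basis `B`) the volume monomial of an HONEST frame (2n pairwise distinct generators) is non-zero, so the top coefficient
  `n!·∏λ_a` is well defined, and `b(λ)ⁿ = 0 ⟺ some λ_a = 0` (`diagForm_pow_eq_zero_iff`: non-degeneracy ⟺ `bⁿ ≠ 0`).

DICTIONARY (on paper, standard linear algebra; NOT asserted in Lean).  For a complex torus `X = V/Λ` of dimension `n`, a real
(1,1)-class `b ∈ H²(X,ℝ) = Λ²H¹(X,ℝ)` is the same thing as a Hermitian form `H_b` on `V`; diagonalising `H_b` against an auxiliary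
positive definite Hermitian form gives a real frame `dx_1, dy_1, …, dx_n, dy_n` of `H¹(X,ℝ)` with `b = ∑_a λ_a dx_a ∧ dy_a`,
`λ_a ∈ ℝ`; `ind(b) := #{a : λ_a < 0}` is frame-independent (Sylvester), `b` is non-degenerate iff every `λ_a ≠ 0`, and the complex
orientation gives `∫_X dx_1∧dy_1∧⋯∧dx_n∧dy_n > 0`.  Hence, by `diagForm_pow`: `∫_X bⁿ = n!·(∏_a λ_a)·∫_X vol`, so
**`sign ∫_X bⁿ = (-1)^{ind(b)}`** for non-degenerate `b` — the numerical shadow of Mumford's index theorem for non-degenerate line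
bundles (Mumford, *Abelian Varieties*, §16: `χ(L) = (Lⁿ)/n!`, `h^j(L) = 0` for `j ≠ i(L)`).  CONSEQUENCES FOR (S3), recorded
here and made kernel statements in part 2: (i) (H1) ⟺ `ind(b)` EVEN; it HOLDS for every structure of record (`b ∝ Θ`, `ind = 0`,
and equally for `b ∝ -Θ` at even `n`); (ii) (H1) is NOT a consequence of the Weil-structure axioms STRUCTURE §1.0 / D8 alone
(th-7 A.2 (ii): `B` of type (1,1) with `b` non-degenerate already gives transversal null spaces `W₁ = ann(e^B)`, `W₂ = ann(e^{B̄})`,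
`N = (N∩W₁) ⊕ (N∩W₂)`, i.e. signature `(n,n)`, and a plane `P` of rational Hodge classes): COUNTER-MODEL `X = E⁴`, `a = 0`,
`b = e₁ + e₂ + e₃ - e₄` (`e_i` the fibre classes), `K = ℚ(i)`: non-degenerate of index 1, `∫_X b⁴ = 4!·(1·1·1·(-1)) = -24 < 0`
(part 2, `example`); there §D's own value of `(v,v)_χ` is NEGATIVE at `n = 4` (no HRR obstruction) and POSITIVE at `n ≡ 2 (mod 4)`;
(iii) the SIGNED law (part 2, `signed_parity_law_index`): Lemma-profile `G`-objects at `n = 2m` force `m + ind(b)` ODD — for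
`ind(b) = 0` this is th-7's «only for `n ≢ 0 (mod 4)`», for `ind(b)` odd it reads «only for `n ≡ 0 (mod 4)`».  The visible binder
that (S3) therefore carries is «`ind(b)` even» (e.g. `b` or `-b` a polarisation class), not «Weil type of signature (n,n)».

All statements and proofs: s4-prove-3 (2026-08-23).  Namespace `Summit.Ventures.HSemireg.Mod4Sign`; §3 reuses the wedge model of
`WedgeModel.lean` / `WedgeModelCoord.lean` (th-7 / p3) by import, and §1 the tree lemma `Commute.add_pow_succ_of_sq_eq_zero`
(pointer: s4-prove-1, bus 2026-08-23T04:53Z), nothing restated.  ×2 RECORD: s4-prove-1's `SecantParityPositivity.lean`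
(namespace `SecantParity`, determinant route `β_hᵍ = det h • ω₀ᵍ`, any Hermitian `h`) reaches the same three statements
((H1) ⟺ ind(b) even; the E⁴ counter-model; the signed law) by a different mechanism — independent seats, 2026-08-23.
-/

open Module

namespace Summit.Ventures.HSemireg.Mod4Sign

/-! ### §1 Algebraic core: the `n`-th power of a sum of `n` pairwise commuting square-zero elements -/

section CoreAux

variable {R : Type*} [Ring R]

/-- Absorption: a square-zero member of a pairwise commuting family kills the product of any list of the
family containing it. -/
theorem mul_prod_map_eq_zero {ι : Type*} (z : ι → R) (hcomm : ∀ i j, Commute (z i) (z j))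
    (hsq : ∀ i, z i * z i = 0) {i : ι} : ∀ {l : List ι}, i ∈ l → z i * (l.map z).prod = 0
  | [], h => by simp at h
  | j :: l, h => by
    rw [List.map_cons, List.prod_cons, ← mul_assoc]
    rcases List.mem_cons.mp h with rfl | h
    · rw [hsq, zero_mul]
    · rw [(hcomm i j).eq, mul_assoc, mul_prod_map_eq_zero z hcomm hsq h, mul_zero]

end CoreAux

section Core

variable {K : Type*} [CommRing K] {R : Type*} [Ring R] [Algebra K R]

/-- CORE IDENTITY.  For `n` pairwise commuting square-zero elements `z_a` of a `K`-algebra and scalars `c_a`: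
`(∑_a c_a z_a)^n = (n! · ∏_a c_a) · z_0 z_1 ⋯ z_{n-1}`. -/
theorem sum_smul_pow_eq : ∀ (n : ℕ) (z : Fin n → R) (c : Fin n → K),
    (∀ i j, Commute (z i) (z j)) → (∀ i, z i * z i = 0) →
      (∑ i, c i • z i) ^ n = ((n.factorial : K) * ∏ i, c i) • (List.ofFn z).prod
  | 0, z, c, _, _ => by simp
  | n + 1, z, c, hcomm, hsq => by
    have ih := sum_smul_pow_eq n (fun i => z i.succ) (fun i => c i.succ) (fun i j => hcomm _ _)
      (fun i => hsq _)
    have hAS : Commute (c 0 • z 0) (∑ i : Fin n, c i.succ • z i.succ) :=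
      Commute.sum_right _ _ _ fun i _ => ((hcomm 0 i.succ).smul_left (c 0)).smul_right (c i.succ)
    have hA : (c 0 • z 0) * (c 0 • z 0) = 0 := by
      rw [smul_mul_smul_comm, hsq, smul_zero]
    have hSP : (∑ i : Fin n, c i.succ • z i.succ) * (List.ofFn fun i => z i.succ).prod = 0 := by
      rw [Finset.sum_mul]
      refine Finset.sum_eq_zero fun i _ => ?_
      rw [smul_mul_assoc, List.ofFn_eq_map,
        mul_prod_map_eq_zero (fun i => z i.succ) (fun i j => hcomm _ _) (fun i => hsq _)
          (List.mem_finRange i), smul_zero]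
    have hS : (∑ i : Fin n, c i.succ • z i.succ) ^ (n + 1) = 0 := by
      rw [pow_succ', ih, mul_smul_comm, hSP, smul_zero]
    rw [Fin.sum_univ_succ, hAS.add_pow_succ_of_sq_eq_zero hA n, hS, zero_add, ih,
      smul_mul_smul_comm, ← Nat.cast_smul_eq_nsmul K (n + 1), smul_smul, List.ofFn_succ, List.prod_cons,
      Nat.factorial_succ, Fin.prod_univ_succ]
    congr 1
    push_cast
    ring

end Core

/-! ### §2 The frame-free model: `b = ∑ λ_a dx_a ∧ dy_a` in the exterior algebra of any module -/

section Model

variable (K : Type*) [CommRing K] {M : Type*} [AddCommGroup M] [Module K M]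

open ExteriorAlgebra

/-- the (1,1)-monomial `dx ∧ dy` of a frame pair `(dx, dy)`. -/
noncomputable def omega (e f : M) : ExteriorAlgebra K M := ι K e * ι K f

/-- the diagonal (1,1)-class `b(λ) = ∑_a λ_a · dx_a ∧ dy_a` of a frame `(dx_a, dy_a)_a`. -/
noncomputable def diagForm {n : ℕ} (e f : Fin n → M) (lam : Fin n → K) : ExteriorAlgebra K M :=
  ∑ a, lam a • omega K (e a) (f a)

/-- the volume monomial `dx_0 ∧ dy_0 ∧ dx_1 ∧ dy_1 ∧ ⋯ ∧ dx_{n-1} ∧ dy_{n-1}` of a frame. -/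
noncomputable def vol {n : ℕ} (e f : Fin n → M) : ExteriorAlgebra K M :=
  (List.ofFn fun a => omega K (e a) (f a)).prod

/-- generators anticommute. -/
lemma ι_mul_ι_eq_neg (x y : M) : ι K x * ι K y = -(ι K y * ι K x) :=
  eq_neg_of_add_eq_zero_left (ι_add_mul_swap x y)

/-- a (1,1)-monomial commutes with every generator. -/
lemma commute_omega_ι (e f x : M) : Commute (omega K e f) (ι K x) := by
  change ι K e * ι K f * ι K x = ι K x * (ι K e * ι K f)
  rw [mul_assoc, ι_mul_ι_eq_neg K f x, mul_neg, ← mul_assoc, ι_mul_ι_eq_neg K e x, neg_mul, neg_neg,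
    mul_assoc]

/-- (1,1)-monomials commute pairwise. -/
lemma commute_omega (e f e' f' : M) : Commute (omega K e f) (omega K e' f') :=
  (commute_omega_ι K e f e').mul_right (commute_omega_ι K e f f')

/-- a (1,1)-monomial squares to zero. -/
lemma omega_mul_self (e f : M) : omega K e f * omega K e f = 0 := by
  change ι K e * ι K f * (ι K e * ι K f) = 0
  rw [mul_assoc, ← mul_assoc (ι K f) (ι K e), ι_mul_ι_eq_neg K f e, neg_mul, mul_neg,
    mul_assoc, ι_sq_zero, mul_zero, mul_zero, neg_zero]

/-- SIGN LAW (frame-free form).  For ANY module `M`, any frame `(dx_a, dy_a)_{a<n}` in `M` and any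
coefficients `λ_a`: `b(λ)^n = (n! · ∏_a λ_a) · vol`. -/
theorem diagForm_pow {n : ℕ} (e f : Fin n → M) (lam : Fin n → K) :
    diagForm K e f lam ^ n = ((n.factorial : K) * ∏ a, lam a) • vol K e f :=
  sum_smul_pow_eq n (fun a => omega K (e a) (f a)) lam (fun _ _ => commute_omega K _ _ _ _)
    fun _ => omega_mul_self K _ _

/-- The same through any `K`-linear functional `deg` (on paper: `deg = ∫_X`, the top-degree coordinate):
`deg(bⁿ) = n! · (∏ λ_a) · deg(vol)`. -/
theorem linearForm_diagForm_pow {n : ℕ} (deg : ExteriorAlgebra K M →ₗ[K] K) (e f : Fin n → M)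
    (lam : Fin n → K) :
    deg (diagForm K e f lam ^ n) = (n.factorial : K) * (∏ a, lam a) * deg (vol K e f) := by
  rw [diagForm_pow, map_smul, smul_eq_mul, mul_assoc]

end Model

/-! ### §3 The coordinate model: the volume monomial of an honest frame is non-zero -/

section Coord

variable (K : Type*) [Field K] {I : Type*} [LinearOrder I] [Fintype I]

open Summit.Ventures.HSemireg.Wedge

/-- a generator monomial of the wedge model is `ι` of the corresponding basis vector. -/
lemma gx_eq_ι (i : I) : gx K i = ExteriorAlgebra.ι K (b K I i) := by
  rw [gx, B, ExteriorAlgebra.basis_apply_ofCard (b K I) (Finset.card_singleton i)]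
  simp [ExteriorAlgebra.ιMulti_family, ExteriorAlgebra.ιMulti_apply,
    Set.powersetCard.ofFinEmbEquiv_symm_apply]

/-- the empty monomial is `1`. -/
lemma B_empty : B K I ∅ = 1 := by
  rw [B, ExteriorAlgebra.basis_apply_ofCard (b K I) Finset.card_empty]
  simp [ExteriorAlgebra.ιMulti_family]

/-- `1 ∈ Alg D`. -/
lemma one_mem_Alg (D : Finset I) : (1 : HT K I) ∈ Alg K I D := by
  rw [← B_empty K]
  exact B_mem_Alg K (Finset.empty_subset D)

/-- a list product of elements of `Alg D` lies in `Alg D`. -/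
lemma list_prod_mem_Alg (D : Finset I) : ∀ l : List (HT K I), (∀ x ∈ l, x ∈ Alg K I D) → l.prod ∈ Alg K I D
  | [], _ => by rw [List.prod_nil]; exact one_mem_Alg K D
  | x :: l, h => by
    rw [List.prod_cons]
    exact mul_mem_Alg K (h x (by simp)) (list_prod_mem_Alg D l fun y hy => h y (by simp [hy]))

/-- NON-VANISHING OF THE VOLUME MONOMIAL.  In the wedge model on generators `I`, for a frame given by
`2n` pairwise distinct generators `p a`, `q a` (`a < n`), `vol = ∏_a e_{p a} ∧ e_{q a} ≠ 0`. -/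
theorem vol_ne_zero : ∀ (n : ℕ) (p q : Fin n → I), Function.Injective (Sum.elim p q) →
    vol K (fun a => b K I (p a)) (fun a => b K I (q a)) ≠ 0
  | 0, p, q, _ => by simp [vol]
  | n + 1, p, q, h => by
    classical
    have h' : Function.Injective (Sum.elim (fun a : Fin n => p a.succ) (fun a : Fin n => q a.succ)) := by
      have : Sum.elim (fun a : Fin n => p a.succ) (fun a : Fin n => q a.succ) =
          Sum.elim p q ∘ Sum.map Fin.succ Fin.succ := by
        ext x; cases x <;> rfl
      rw [this]
      exact h.comp (Sum.map_injective.mpr ⟨Fin.succ_injective n, Fin.succ_injective n⟩)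
    have ih := vol_ne_zero n (fun a => p a.succ) (fun a => q a.succ) h'
    -- the support of the tail
    let D : Finset I := Finset.univ.image (fun a : Fin n => p a.succ) ∪
      Finset.univ.image (fun a : Fin n => q a.succ)
    have hp0 : p 0 ∉ D := by
      intro hm
      rcases Finset.mem_union.mp hm with hm | hm
      · obtain ⟨a, -, ha⟩ := Finset.mem_image.mp hm
        have := h (show Sum.elim p q (Sum.inl a.succ) = Sum.elim p q (Sum.inl 0) from ha)
        exact Fin.succ_ne_zero a (Sum.inl_injective this)
      · obtain ⟨a, -, ha⟩ := Finset.mem_image.mp hm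
        have := h (show Sum.elim p q (Sum.inr a.succ) = Sum.elim p q (Sum.inl 0) from ha)
        exact Sum.inr_ne_inl this
    have hq0 : q 0 ∉ D := by
      intro hm
      rcases Finset.mem_union.mp hm with hm | hm
      · obtain ⟨a, -, ha⟩ := Finset.mem_image.mp hm
        have := h (show Sum.elim p q (Sum.inl a.succ) = Sum.elim p q (Sum.inr 0) from ha)
        exact Sum.inl_ne_inr this
      · obtain ⟨a, -, ha⟩ := Finset.mem_image.mp hm
        have := h (show Sum.elim p q (Sum.inr a.succ) = Sum.elim p q (Sum.inr 0) from ha)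
        exact Fin.succ_ne_zero a (Sum.inr_injective this)
    have hpq : p 0 ≠ q 0 := fun e =>
      Sum.inl_ne_inr (h (show Sum.elim p q (Sum.inl 0) = Sum.elim p q (Sum.inr 0) from e))
    have hmem : vol K (fun a : Fin n => b K I (p a.succ)) (fun a : Fin n => b K I (q a.succ)) ∈ Alg K I D := by
      apply list_prod_mem_Alg K D
      intro x hx
      rw [List.mem_ofFn] at hx
      obtain ⟨a, rfl⟩ := hx
      rw [omega, ← gx_eq_ι, ← gx_eq_ι]
      exact mul_mem_Alg K (B_mem_Alg K (by simp [D])) (B_mem_Alg K (by simp [D]))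
    have hc : Commute (omega K (b K I (p 0)) (b K I (q 0)))
        (vol K (fun a : Fin n => b K I (p a.succ)) (fun a : Fin n => b K I (q a.succ))) :=
      Commute.list_prod_right _ _ fun x hx => by
        rw [List.mem_ofFn] at hx
        obtain ⟨a, rfl⟩ := hx
        exact commute_omega K _ _ _ _
    intro h0
    rw [vol, List.ofFn_succ, List.prod_cons] at h0
    change omega K (b K I (p 0)) (b K I (q 0)) *
      vol K (fun a : Fin n => b K I (p a.succ)) (fun a : Fin n => b K I (q a.succ)) = 0 at h0
    rw [hc.eq, omega, ← gx_eq_ι, ← gx_eq_ι] at h0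
    exact ih (eq_zero_of_mul_xy K hp0 hq0 hpq hmem h0)

/-- COORDINATE SIGN LAW with an honest frame: `b(λ)^n = (n!·∏λ_a)·vol` with `vol ≠ 0`, so the top
coefficient `n!·∏λ_a` of `bⁿ` is well defined; in particular `bⁿ = 0 ↔ some λ_a = 0`
(non-degeneracy of `b` ⟺ all `λ_a ≠ 0` ⟺ `bⁿ ≠ 0`). -/
theorem diagForm_pow_eq_zero_iff [CharZero K] {n : ℕ} (p q : Fin n → I)
    (h : Function.Injective (Sum.elim p q)) (lam : Fin n → K) :
    diagForm K (fun a => b K I (p a)) (fun a => b K I (q a)) lam ^ n = 0 ↔ ∃ a, lam a = 0 := by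
  rw [diagForm_pow, smul_eq_zero, mul_eq_zero, Finset.prod_eq_zero_iff]
  constructor
  · rintro ((h0 | ⟨a, -, ha⟩) | h0)
    · exact absurd h0 (Nat.cast_ne_zero.mpr (Nat.factorial_ne_zero n))
    · exact ⟨a, ha⟩
    · exact absurd h0 (vol_ne_zero K n p q h)
  · rintro ⟨a, ha⟩
    exact Or.inl (Or.inr ⟨a, Finset.mem_univ a, ha⟩)

end Coord

end Summit.Ventures.HSemireg.Mod4Sign
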